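import Literature.Geometry.Lorentzian.KerrConvergenceProofs
import HarnessLib

/-!
# `KerrRadiusBandCover`: band covering and inner density for the Kerr–Schild cylinders `{r = c}`
(crux `GapExhaustion`, stmt-FinalStateConjecture-10808, line photon-shell-pseudoconvexity;
stub (S-2) `stub_kerrRadius_bandCover` of §1g SWEEP)

The line's outward sweeps extend Killing fields across the Kerr–Schild cylinders `{r = c}` of the
Kerr–Schild radius `r = Kerr.radius a` (the nonnegative root of
`r⁴ − (‖x⃗‖² − a²) r² − a² x₃² = 0`, Visser arXiv:0706.0622, (35)). The abstract level-set sweep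
needs two elementary facts about the level function, for `0 < c`, `|a| ≤ c`:

* (cover) every point `y` with `c ≤ r(y)` is within distance `2 (r(y) − c)` of a point `x` of the
  cylinder `{r = c}` with the same time coordinate;
* (density) `{r ≤ c} ⊆ closure {r < c}`.

Both follow from the **spatial scaling inequality** `r(t, μ x⃗) ≤ μ r(t, x⃗)` for `0 < μ ≤ 1`
(`kerrBandCover_radius_scale_le`), which we obtain from the joint homogeneity
`r_{μa}(μ x) = μ r_a(x)` (`Kerr.radius_smul`) and the monotonicity of the radius in the spin,
`a'² ≤ a² ⇒ r_a ≤ r_{a'}` (`kerrBandCover_radius_le_radius_of_sq_le`, from the closed form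
`r² = ((ρ² − a²) + √((ρ² − a²)² + 4a²z²))/2`). The cover point is produced by the intermediate
value theorem along `μ ↦ (y⁰, μ y⃗)`, `μ ∈ [0, 1]`; the density by letting `μ → 1⁻`. [folklore]
-/

noncomputable section

-- D-0017: single-problem summit, `Summit.<S>.<S>.…` by design (cf. lakefile `weak.linter.dupNamespace`).
set_option linter.dupNamespace false

namespace Summit.FinalStateConjecture.FinalStateConjecture.Theorems

open Set Literature.Geometry.Lorentzian
open scoped Topology

/-- The function `b ↦ (S − b) + √((S − b)² + 4 b z²)` (twice the squared Kerr–Schild radius as a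
function of `b = a²`, `S = ‖x⃗‖²`, `z = x₃`) is antitone on `0 ≤ b` as soon as `z² ≤ S`
(Visser arXiv:0706.0622, (35)). [folklore] -/
private theorem kerrBandCover_add_sqrt_le {S z b b' : ℝ} (hb' : 0 ≤ b') (hb : b' ≤ b)
    (hz : z ^ 2 ≤ S) :
    (S - b) + √((S - b) ^ 2 + 4 * b * z ^ 2) ≤ (S - b') + √((S - b') ^ 2 + 4 * b' * z ^ 2) := by
  obtain ⟨D', hD'⟩ : ∃ D' : ℝ, D' = (S - b') ^ 2 + 4 * b' * z ^ 2 := ⟨_, rfl⟩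
  have hD'0 : 0 ≤ D' := by rw [hD']; positivity
  have hs0 : 0 ≤ √D' := Real.sqrt_nonneg _
  have hs2 : √D' ^ 2 = D' := Real.sq_sqrt hD'0
  -- `2 z² − (S − b') ≤ √D'` since `(2 z² − (S − b'))² = D' − 4 z² (S − z²) ≤ D'`
  have h1 : 2 * z ^ 2 - (S - b') ≤ √D' := by
    refine (le_abs_self _).trans (Real.abs_le_sqrt ?_)
    nlinarith [mul_nonneg (sq_nonneg z) (sub_nonneg.2 hz)]
  have h2 : (b - b') * (2 * z ^ 2 - (S - b')) ≤ (b - b') * √D' :=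
    mul_le_mul_of_nonneg_left h1 (sub_nonneg.2 hb)
  have h3 : √((S - b) ^ 2 + 4 * b * z ^ 2) ≤ (b - b') + √D' := by
    rw [Real.sqrt_le_left (by linarith)]
    nlinarith [h2, hs2]
  rw [← hD']
  linarith

/-- **The Kerr–Schild radius is antitone in the spin**: `a'² ≤ a²` implies `r_a(x) ≤ r_{a'}(x)`
(from the closed form `r² = ((ρ² − a²) + √((ρ² − a²)² + 4a²z²))/2` of Visser arXiv:0706.0622,
(35), using `z² ≤ ρ²`; e.g. `r_a(x) ≤ r_0(x) = ‖x⃗‖`). [folklore] -/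
theorem kerrBandCover_radius_le_radius_of_sq_le {a a' : ℝ} (h : a' ^ 2 ≤ a ^ 2) (x : E4) :
    Kerr.radius a x ≤ Kerr.radius a' x := by
  have hz : x 3 ^ 2 ≤ E4.spatialNorm x ^ 2 := by
    rw [E4.spatialNorm_sq]
    nlinarith [sq_nonneg (x 1), sq_nonneg (x 2)]
  unfold Kerr.radius
  exact Real.sqrt_le_sqrt
    (div_le_div_of_nonneg_right (kerrBandCover_add_sqrt_le (sq_nonneg a') h hz) zero_le_two)

/-- **Spatial scaling shrinks the Kerr–Schild radius at least linearly**: for `0 < μ ≤ 1`,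
`r_a(t, μ x⃗) ≤ μ r_a(t, x⃗)`. Indeed `r_a(t, μ x⃗) ≤ r_{μa}(t, μ x⃗) = μ r_a(t, x⃗)` by the
monotonicity in the spin and the joint homogeneity of the defining quartic (Visser
arXiv:0706.0622, (35)). [folklore] -/
theorem kerrBandCover_radius_scale_le (a : ℝ) (y : E4) {μ : ℝ} (hμ0 : 0 < μ) (hμ1 : μ ≤ 1) :
    Kerr.radius a (E4.ofTimeSpace (y 0) (μ • E4.spatial y)) ≤ μ * Kerr.radius a y := by
  have hμ2 : μ ^ 2 ≤ 1 := by nlinarith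
  have hsq : (μ * a) ^ 2 ≤ a ^ 2 := by
    calc (μ * a) ^ 2 = μ ^ 2 * a ^ 2 := mul_pow μ a 2
      _ ≤ 1 * a ^ 2 := mul_le_mul_of_nonneg_right hμ2 (sq_nonneg a)
      _ = a ^ 2 := one_mul _
  have h1 := kerrBandCover_radius_le_radius_of_sq_le hsq (E4.ofTimeSpace (y 0) (μ • E4.spatial y))
  have h2 : Kerr.radius (μ * a) (E4.ofTimeSpace (y 0) (μ • E4.spatial y)) =
      Kerr.radius (μ * a) (μ • y) :=
    Kerr.radius_eq_of_spatial_eq _ (by rw [E4.spatial_ofTimeSpace, map_smul])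
  rw [h2, Kerr.radius_smul hμ0] at h1
  exact h1

/-- A point with vanishing spatial part has Kerr–Schild radius `≤ 0` (hence `= 0`):
`r_a(t, 0) ≤ r_0(t, 0) = ‖0‖ = 0` (Visser arXiv:0706.0622, (35)). [folklore] -/
private theorem kerrBandCover_radius_ofTimeSpace_zero_le (a t : ℝ) :
    Kerr.radius a (E4.ofTimeSpace t 0) ≤ 0 := by
  have h := kerrBandCover_radius_le_radius_of_sq_le (a := a) (a' := 0)
    (by rw [sq, zero_mul]; exact sq_nonneg a) (E4.ofTimeSpace t 0)
  rwa [Kerr.radius_zero_left, E4.spatialNorm_ofTimeSpace, norm_zero] at h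

/-- The displacement of the spatial scaling `(y⁰, y⃗) ↦ (y⁰, μ y⃗)` has norm `|μ − 1| ‖y⃗‖`
(Euclidean norm of `E4 = EuclideanSpace ℝ (Fin 4)`). [folklore] -/
private theorem kerrBandCover_norm_sub (y : E4) (μ : ℝ) :
    ‖E4.ofTimeSpace (y 0) (μ • E4.spatial y) - y‖ = |μ - 1| * E4.spatialNorm y := by
  have h : E4.ofTimeSpace (y 0) (μ • E4.spatial y) - y =
      E4.ofTimeSpace 0 ((μ - 1) • E4.spatial y) := by
    ext i
    refine Fin.cases ?_ (fun j ↦ ?_) i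
    · simp
    · simp [sub_mul]
  have hn : ∀ v : E3, ‖E4.ofTimeSpace 0 v‖ = ‖v‖ := fun v ↦ by
    rw [EuclideanSpace.norm_eq, EuclideanSpace.norm_eq, Fin.sum_univ_succ]
    simp
  rw [h, hn, norm_smul, Real.norm_eq_abs, E4.spatialNorm]

/-- `‖y⃗‖² ≤ r² + a²` wherever `r > 0`: the defining quartic gives
`(‖y⃗‖² − a²) r² = r⁴ − a² y₃² ≤ r⁴` (Visser arXiv:0706.0622, (35); the level sets are the
confocal ellipsoids `(y₁² + y₂²)/(r² + a²) + y₃²/r² = 1`). [folklore] -/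
private theorem kerrBandCover_spatialNorm_sq_le (a : ℝ) {y : E4} (hy : 0 < Kerr.radius a y) :
    E4.spatialNorm y ^ 2 ≤ Kerr.radius a y ^ 2 + a ^ 2 := by
  have hq := Kerr.radius_quartic a y
  have hr2 : 0 < Kerr.radius a y ^ 2 := by positivity
  by_contra h
  have hlt : Kerr.radius a y ^ 2 * Kerr.radius a y ^ 2 <
      (E4.spatialNorm y ^ 2 - a ^ 2) * Kerr.radius a y ^ 2 :=
    mul_lt_mul_of_pos_right (by linarith [not_le.mp h]) hr2
  nlinarith [sq_nonneg (a * y 3)]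

/-- **(S-2) Band covering and inner density of the Kerr–Schild cylinders.** For `0 < c`,
`|a| ≤ c`: every point `y` with `c ≤ r(y)` is within `2 (r(y) − c)` of a point of the level
cylinder `{r = c}` at the same time (spatial scaling `x⃗ ↦ μ x⃗`, `r(t, μ x⃗) ≤ μ r(t, x⃗)` for
`0 < μ ≤ 1`, and the intermediate value theorem in `μ`), and `{r ≤ c} ⊆ closure {r < c}`
(let `μ → 1⁻`). Elementary geometry of the confocal ellipsoids `{r = c}` of the Kerr–Schild
radius (O'Neill 1995, Ch. 2, §2.1; Visser arXiv:0706.0622, (35)). [folklore] -/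
theorem stub_kerrRadius_bandCover :
    ∀ (a c : ℝ), 0 < c → |a| ≤ c →
      (∀ y : E4, c ≤ Kerr.radius a y →
        ∃ x : E4, Kerr.radius a x = c ∧ x 0 = y 0 ∧ ‖x - y‖ ≤ 2 * (Kerr.radius a y - c)) ∧
      {x : E4 | Kerr.radius a x ≤ c} ⊆ closure {x : E4 | Kerr.radius a x < c} := by
  intro a c hc hac
  refine ⟨fun y hy ↦ ?_, fun x hx ↦ ?_⟩
  · -- (cover): IVT along the spatial scaling path `μ ↦ (y⁰, μ y⃗)`, `μ ∈ [0, 1]`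
    have hr0 : 0 < Kerr.radius a y := hc.trans_le hy
    obtain ⟨p, hp⟩ : ∃ p : ℝ → E4, p = fun μ ↦ E4.ofTimeSpace (y 0) (μ • E4.spatial y) :=
      ⟨_, rfl⟩
    have hpc : Continuous p := by
      rw [hp]
      exact (E4.continuous_ofTimeSpace (y 0)).comp (continuous_id.smul continuous_const)
    have hφc : Continuous fun μ ↦ Kerr.radius a (p μ) := (Kerr.continuous_radius a).comp hpc
    have hφ0 : Kerr.radius a (p 0) ≤ 0 := by
      rw [hp]
      simp only [zero_smul]
      exact kerrBandCover_radius_ofTimeSpace_zero_le a (y 0)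
    have hφ1 : Kerr.radius a (p 1) = Kerr.radius a y := by
      rw [hp]
      simp only [one_smul]
      exact Kerr.radius_eq_of_spatial_eq a (E4.spatial_ofTimeSpace _ _)
    obtain ⟨μ, ⟨hμ0, hμ1⟩, hμc⟩ := intermediate_value_Icc zero_le_one hφc.continuousOn
      (show c ∈ Icc (Kerr.radius a (p 0)) (Kerr.radius a (p 1)) from
        ⟨hφ0.trans hc.le, by rw [hφ1]; exact hy⟩)
    have hμc : Kerr.radius a (p μ) = c := hμc
    have hμpos : 0 < μ := by
      rcases hμ0.eq_or_lt with h0 | h0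
      · rw [← h0] at hμc
        linarith
      · exact h0
    have hcμ : c ≤ μ * Kerr.radius a y := by
      rw [← hμc, hp]
      exact kerrBandCover_radius_scale_le a y hμpos hμ1
    refine ⟨p μ, hμc, by rw [hp]; exact E4.ofTimeSpace_apply_zero _ _, ?_⟩
    -- the distance estimate `‖(y⁰, μ y⃗) − y‖ = (1 − μ) ‖y⃗‖ ≤ (1 − μ) 2 r ≤ 2 (r − c)`
    have hS : E4.spatialNorm y ≤ 2 * Kerr.radius a y := by
      have h1 := kerrBandCover_spatialNorm_sq_le a hr0
      have h2 : a ^ 2 ≤ c ^ 2 := by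
        simpa only [sq_abs] using pow_le_pow_left₀ (abs_nonneg a) hac 2
      have h3 : E4.spatialNorm y ^ 2 ≤ (2 * Kerr.radius a y) ^ 2 := by
        nlinarith [mul_le_mul hy hy hc.le (hc.le.trans hy)]
      exact (sq_le_sq₀ (E4.spatialNorm_nonneg y) (by positivity)).1 h3
    rw [hp, kerrBandCover_norm_sub, abs_sub_comm, abs_of_nonneg (by linarith)]
    calc (1 - μ) * E4.spatialNorm y ≤ (1 - μ) * (2 * Kerr.radius a y) :=
        mul_le_mul_of_nonneg_left hS (by linarith)
      _ ≤ 2 * (Kerr.radius a y - c) := by linarith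
  · -- (density): `(x⁰, μ x⃗) → x` as `μ → 1⁻`, with `r(x⁰, μ x⃗) ≤ μ c < c`
    rcases (show Kerr.radius a x ≤ c from hx).lt_or_eq with hlt | heq
    · exact subset_closure hlt
    · obtain ⟨p, hp⟩ : ∃ p : ℝ → E4, p = fun μ ↦ E4.ofTimeSpace (x 0) (μ • E4.spatial x) :=
        ⟨_, rfl⟩
      have hpc : Continuous p := by
        rw [hp]
        exact (E4.continuous_ofTimeSpace (x 0)).comp (continuous_id.smul continuous_const)
      have hp1 : p 1 = x := by
        rw [hp]
        simp only [one_smul]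
        exact E4.ofTimeSpace_time_spatial x
      have ht : Filter.Tendsto p (𝓝[<] 1) (𝓝 x) := by
        have h : Filter.Tendsto p (𝓝[<] 1) (𝓝 (p 1)) :=
          (hpc.tendsto 1).mono_left nhdsWithin_le_nhds
        rwa [hp1] at h
      refine mem_closure_of_tendsto ht ?_
      filter_upwards [Ioo_mem_nhdsLT (zero_lt_one : (0 : ℝ) < 1)] with μ hμ
      show Kerr.radius a (p μ) < c
      calc Kerr.radius a (p μ) ≤ μ * Kerr.radius a x := by
            rw [hp]
            exact kerrBandCover_radius_scale_le a x hμ.1 hμ.2.le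
        _ < c := by
            rw [heq]
            nlinarith [hμ.2]

end Summit.FinalStateConjecture.FinalStateConjecture.Theorems

end
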